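/-
Copyright (c) 2026 the pub-hodgecm-mathlib formalisation cell (harness21).  Prover seat hodgecm-mathlib-LH4-p01 (g10): road M6 → F3 «TOT-Λ BY OVER-ORDERS» (LEAD F0P3a-plan
T14-66 ∕ T15-32 «GO-LOW»), brick F5-(0) v2-U «THE GATE AT THE INERT PLACE, UNIFORMISER ROW» for the F3-5 ∕ F5 pen LH7-p04 (g12); 2026-09-03.
-/
import Literature.NumberTheory.Rogawski1990.SelfDualStableLatticeCountInertPlace       -- ★ F5-(0) p853304 (this seat): `valued_toPlace_eq_sq_of_eisenstein` (and the heads this gate feeds)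
import Literature.NumberTheory.Automorphic.TypeTwoGateAtOverOrderGeneratorWildUnit     -- ★ C8-unit p853179 (F0P3a-p04 (g30)): `SymmetricEigenframe.gate_at_generator_wildUnit`; brings ★ C8-odd p853170 `gate_at_generator_uniform` (ED. 2)
import Literature.NumberTheory.Rogawski1990.InertPlaceThetaPackageUniformiser         -- ★ FILE C p853143 (this seat): `exists_isUnit_moved_by_galAdicCompletionMap` (the trace-unit seed `ω`)
import Literature.NumberTheory.LocalFields.UnramifiedQuadraticNormAtInertPlace        -- ★ `exists_mul_galAdicCompletionMap_eq_of_inert` (unit norms at an inert place)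
import Literature.NumberTheory.Automorphic.UnitaryGroupSplitPlace                      -- ★ `algEquiv_mul_self_eq_one`
import HarnessLib

/-!
# The F4 gate in `Valued`∕Krylov currency at an inert CM place, uniformiser row — ★ F5-(0)'s binder `hgateV` supplied by ★ C8-odd

Topic `NumberTheory/Rogawski1990`; namespace `Literature.NumberTheory.Rogawski1990`.  THEOREMS ONLY (no definition, no instance, no notation, no named fact, no `sorry`).
Cell `pub/hodgecm-mathlib` (D-0151), crux H413 = `stmt-HodgeConjecture-24833`; road M6 → F3 «TOT-Λ by over-orders», brick **F5-(0) v2-U**: ★ F5-(0)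
`ncard_isSelfDualLattice_stable_eq_phiTHn_inertPlace ∕ _phiTHprimen_inertPlace` keep ONE row-level binder, `hgateV` — the F4 gate in `Valued`∕Krylov currency, quantified over
the generators `x′ = (u′, p′ + q′θ)` of the glued over-orders.  On the UNIFORMISER ROW it is ★ C8-odd `SymmetricEigenframe.gate_at_generator_uniform`, whose `τ`-free package at
the place is: the row's θ-package WITH ITS SECOND INVOLUTION `ι′` (`ι′θ = −θ`; ★ `exists_thetaPackage_uniformiserRow_involution` delivers `θ s̃ ι′`, (rE), (nE) and
`|θ − ι′θ| = q^{−(2s+1)}` in one `obtain`) — BINDERS here, letters verbatim —, and, DISCHARGED INSIDE: the unit norms of the inert `E_w ∕ F_v` (★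
`exists_mul_galAdicCompletionMap_eq_of_inert`), `2 ≠ 0` (characteristic `0`), the trace-unit seed `ω = −a·b` with `b·(σ_w a − a) = 1` (★ FILE C
`exists_isUnit_moved_by_galAdicCompletionMap`; `σ_w b = −b`, so `ω + σ_w ω = b·(σ_w a − a) = 1`, `|ω| ≤ 1`), `|ι₁ y| = |y|²` (★ F5-(0) `valued_toPlace_eq_sq_of_eisenstein`), `χ_g`
rootless (★ (c5-i) `charpoly_ne_zero_of_eisensteinData`).  USE (F5, uniformiser row): `ncard_isSelfDualLattice_stable_eq_phiTHn_inertPlace … P hP hPx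
(gateV_inertPlace_uniformiserRow c v hc hunr w hw w₁ haF hk₀ s' hθ hθv hcoord hs'ι hs's' hs'v hnorm1 J hJ hJh cfr φb hφb φ hstar hΘ hΘd hΘt hlam hφx hall hcoordlam ι' hι'j hι'θ
hι'ι hι'v hs'ι' hrE hnE hθs) hI`.
HONEST LABEL: HC_CM is proved only modulo the 2 remaining named inputs (hLiu418 24832, h413 24833) until rung 0 closes; assembly of ★ bricks, asserts nothing printed;
count-neutral (pays no organ; zero label movement until F5 ★ and a desk-priced rider).

* **`gateV_inertPlace_uniformiserRow`**.

## References
* [Rogawski1990] J. D. Rogawski, *Automorphic Representations of Unitary Groups in Three Variables*, Ann. of Math. Stud. 123 (1990): §4.9 Lemma 4.9.3 p. 56, Prop. 4.9.1 (b) p. 55.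
* [Kottwitz1986BaseChangeUnits] R. E. Kottwitz, *Base change for unit elements of Hecke algebras*, Compositio Math. 60 (1986): §1 pp. 240–241, §3.
* [Flicker1998UnitaryFL] Y. Z. Flicker, *Elementary proof of the fundamental lemma for a unitary group*, Canad. J. Math. 50 (1998): Props. 7, 11, 16–17, Theorem 18 p. 97.
* [Jacobowitz1962] R. Jacobowitz, *Hermitian forms over local fields*, Amer. J. Math. 84 (1962): §5, §7 Thm. 7.1.
* [SerreLocalFields1979] J.-P. Serre, *Local Fields*, GTM 67 (1979): Ch. V §2 Prop. 3 (unit norms, unramified case).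
-/

set_option autoImplicit false

noncomputable section

open Matrix Polynomial ValuativeRel NumberField IsDedekindDomain
open scoped MatrixGroups ValuativeRel Pointwise WithZero
open Literature.NumberTheory.Automorphic Literature.NumberTheory.Automorphic.UnitaryGroup Literature.NumberTheory.NumberFields
  Literature.NumberTheory.Rogawski1990.Flicker1998 Literature.NumberTheory.Automorphic.UnitaryLatticeTree Literature.NumberTheory.Automorphic.HermitianLattice

namespace Literature.NumberTheory.Rogawski1990

variable {F E : Type} [Field F] [NumberField F] [Field E] [NumberField E] [Algebra F E] [Algebra.IsQuadraticExtension F E]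
  (c : E ≃ₐ[F] E) (v : HeightOneSpectrum (𝓞 F)) (hc : c ≠ 1) (hunr : Algebra.IsUnramifiedIn (𝓞 E) v.asIdeal)
  (w : PlacesOver E v) (hw : c • w.1 = w.1)
  {M : Type} [Field M] [NumberField M] [Algebra E M] (w₁ : PlacesOver M w.1)
  -- the field-level θ-package of the uniformiser row (★ `exists_thetaPackage_uniformiserRow_involution`'s first letters)
  {aF k₀ : v.adicCompletion F} (haF : Valued.v aF < 1) (hk₀ : Valued.v k₀ = WithZero.exp (-1 : ℤ))
  {θ : w₁.1.adicCompletion M} (s' : w₁.1.adicCompletion M →+* w₁.1.adicCompletion M)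
  (hθ : θ ^ 2 = toPlace w.1 w₁ (toPlace v w aF) * θ + toPlace w.1 w₁ (toPlace v w k₀)) (hθv : Valued.v θ = WithZero.exp (-1 : ℤ))
  (hcoord : ∀ z : w₁.1.adicCompletion M, ∃! pq : w.1.adicCompletion E × w.1.adicCompletion E, z = toPlace w.1 w₁ pq.1 + toPlace w.1 w₁ pq.2 * θ)
  (hs'ι : ∀ x, s' (toPlace w.1 w₁ x) = toPlace w.1 w₁ (galAdicCompletionMap (L := E) c hw x)) (hs's' : ∀ z, s' (s' z) = z)
  (hs'v : ∀ z, Valued.v (s' z) = Valued.v z)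
  (hnorm1 : ∀ c₁ : w₁.1.adicCompletion M, c₁ ≠ 0 → s' c₁ = c₁ → Even (WithZero.log (Valued.v c₁)) → ∃ a : w₁.1.adicCompletion M, a * s' a * c₁ = 1)
  -- the form
  (J : GL (Fin 3) (w.1.adicCompletion E)) (hJ : J ∈ glInt 3 (w.1.adicCompletion E))
  (hJh : ((J : Matrix (Fin 3) (Fin 3) (w.1.adicCompletion E)).map (galAdicCompletionMap (L := E) c hw))ᵀ = J)
  -- the block frame and its endoscopic presentation at the pair (★ FILE B's conclusions at the unitary pair, reused at its shifts)
  (cfr : GL (Fin 3) (w.1.adicCompletion E))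
  (φb : (Matrix (Fin 2) (Fin 2) (w.1.adicCompletion E) × w.1.adicCompletion E) →ₐ[w.1.adicCompletion E] Matrix (Fin 3) (Fin 3) (w.1.adicCompletion E))
  (hφb : ∀ (g : Matrix (Fin 2) (Fin 2) (w.1.adicCompletion E)) (u : w.1.adicCompletion E),
    φb (g, u) = (cfr : Matrix (Fin 3) (Fin 3) (w.1.adicCompletion E)) *
      Matrix.reindex endoPerm endoPerm (Matrix.fromBlocks g 0 0 (u • (1 : Matrix (Fin 1) (Fin 1) (w.1.adicCompletion E)))) *
      ((cfr⁻¹ : GL (Fin 3) (w.1.adicCompletion E)) : Matrix (Fin 3) (Fin 3) (w.1.adicCompletion E)))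
  (φ : (w.1.adicCompletion E × w₁.1.adicCompletion M) →ₐ[w.1.adicCompletion E] Matrix (Fin 3) (Fin 3) (w.1.adicCompletion E))
  (hstar : ∀ b : w.1.adicCompletion E × w₁.1.adicCompletion M, (J : Matrix (Fin 3) (Fin 3) (w.1.adicCompletion E)) *
    φ (RingHom.prodMap (galAdicCompletionMap (L := E) c hw) s' b) = ((φ b).map (galAdicCompletionMap (L := E) c hw))ᵀ * J)
  -- the pair: `Θ = α•1 + β•g` Eisenstein (⇒ `χ_g` rootless), a root `λ ∈ M_{w₁}` of `χ_g`, `φ(u, λ) = φ_b(g, u)`, `E_w × M_{w₁} = E_w[(u, λ)]`, coordinates on `(1, λ)`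
  {g Θ : Matrix (Fin 2) (Fin 2) (w.1.adicCompletion E)} {u α β : w.1.adicCompletion E}
  (hΘ : Θ = α • 1 + β • g) (hΘd : Valued.v Θ.det = Valued.v (toPlace v w k₀)) (hΘt : Valued.v Θ.trace < 1)
  {lam : w₁.1.adicCompletion M} (hlam : lam ^ 2 - toPlace w.1 w₁ g.trace * lam + toPlace w.1 w₁ g.det = 0)
  (hφx : φ ((u, lam) : w.1.adicCompletion E × w₁.1.adicCompletion M) = φb (g, u))
  (hall : ∀ x : w.1.adicCompletion E × w₁.1.adicCompletion M, ∃ Q : (w.1.adicCompletion E)[X], aeval ((u, lam) : w.1.adicCompletion E × w₁.1.adicCompletion M) Q = x)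
  (hcoordlam : ∀ z : w₁.1.adicCompletion M, ∃ p q : w.1.adicCompletion E, z = toPlace w.1 w₁ p + toPlace w.1 w₁ q * lam)
  -- the second involution `ι′` of the uniformiser row and the gate's dictionaries (★ `exists_thetaPackage_uniformiserRow_involution`'s extra letters)
  (ι' : w₁.1.adicCompletion M →+* w₁.1.adicCompletion M) (hι'j : ∀ x, ι' (toPlace w.1 w₁ x) = toPlace w.1 w₁ x) (hι'θ : ι' θ = -θ) (hι'ι : ∀ z, ι' (ι' z) = z)
  (hι'v : ∀ z, Valued.v (ι' z) = Valued.v z) (hs'ι' : ∀ z, s' (ι' z) = ι' (s' z))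
  (hrE : ∀ x : w₁.1.adicCompletion M, x ≠ 0 → ι' x = x → Even (WithZero.log (Valued.v x)))
  (hnE : ∀ c₁ : w₁.1.adicCompletion M, c₁ ≠ 0 → s' c₁ = c₁ → ι' c₁ = c₁ → (4 : ℤ) ∣ WithZero.log (Valued.v c₁) →
    ∃ a : w₁.1.adicCompletion M, ι' a = a ∧ a * s' a * c₁ = 1)
  {s : ℕ} (hθs : Valued.v (θ - ι' θ) = WithZero.exp (-((2 * s + 1 : ℕ) : ℤ)))

include hc hunr haF hk₀ hθ hθv hcoord hs'ι hs's' hs'v hnorm1 hJ hJh hφb hstar hΘ hΘd hΘt hlam hφx hall hcoordlam hι'j hι'θ hι'ι hι'v hs'ι' hrE hnE hθs in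
/-- **THE GATE `hgateV` ON THE UNIFORMISER ROW** (★ F5-(0)'s binder, discharged): ★ C8-odd `gate_at_generator_uniform` at the place, its `τ`-free package read from the row's
θ-package with `ι′`, the unit norms of the inert `E_w ∕ F_v` (★ `exists_mul_galAdicCompletionMap_eq_of_inert`), `2 ≠ 0`, and the trace-unit seed `ω = −a·b`, `b·(σ_w a − a) = 1`
(★ FILE C `exists_isUnit_moved_by_galAdicCompletionMap`; `σ_w b = −b`, so `ω + σ_w ω = b·(σ_w a − a) = 1`).
[cite: Rogawski1990, §4.9 Lemma 4.9.3 p. 56, Prop. 4.9.1 (b) p. 55] [cite: Jacobowitz1962, §7 Thm. 7.1] [cite: SerreLocalFields1979, Ch. V §2 Prop. 3] -/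
theorem gateV_inertPlace_uniformiserRow (u' p' q' t' D' : w.1.adicCompletion E) (N'' b' : ℕ)
    (hunit : ((u', toPlace w.1 w₁ p' + toPlace w.1 w₁ q' * θ) : w.1.adicCompletion E × w₁.1.adicCompletion M) *
      RingHom.prodMap (galAdicCompletionMap (L := E) c hw) s' ((u', toPlace w.1 w₁ p' + toPlace w.1 w₁ q' * θ) : w.1.adicCompletion E × w₁.1.adicCompletion M) = 1)
    (hu1 : Valued.v (u' - 1) < 1) (hp1 : Valued.v (p' - 1) < 1) (hq : Valued.v q' = WithZero.exp (-(N'' : ℤ)))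
    (hquad : (toPlace w.1 w₁ p' + toPlace w.1 w₁ q' * θ) ^ 2 - toPlace w.1 w₁ t' * (toPlace w.1 w₁ p' + toPlace w.1 w₁ q' * θ) + toPlace w.1 w₁ D' = 0)
    (hb' : Valued.v (u' * u' - t' * u' + D') = WithZero.exp (-(b' : ℤ))) :
    (∃ x : Fin 3 → w.1.adicCompletion E, ∃ g₁ ∈ unitaryGroupOfForm (galAdicCompletionMap (L := E) c hw) (J : Matrix (Fin 3) (Fin 3) (w.1.adicCompletion E)),
      Submodule.span 𝒪[w.1.adicCompletion E] (Set.range fun k : Fin 3 =>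
        ((φ ((u', toPlace w.1 w₁ p' + toPlace w.1 w₁ q' * θ) : w.1.adicCompletion E × w₁.1.adicCompletion M)) ^ (k : ℕ)) *ᵥ x) =
        Submodule.span 𝒪[w.1.adicCompletion E] (Set.range ((g₁ : Matrix (Fin 3) (Fin 3) (w.1.adicCompletion E)))ᵀ)) ↔
    Even (WithZero.log (Valued.v (∑ k, ∑ i,
      galAdicCompletionMap (L := E) c hw (((cfr : Matrix (Fin 3) (Fin 3) (w.1.adicCompletion E)) *ᵥ Pi.single (endoPerm (Sum.inr 0)) (1 : w.1.adicCompletion E)) i) *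
      (J : Matrix (Fin 3) (Fin 3) (w.1.adicCompletion E)) i k *
      ((cfr : Matrix (Fin 3) (Fin 3) (w.1.adicCompletion E)) *ᵥ Pi.single (endoPerm (Sum.inr 0)) (1 : w.1.adicCompletion E)) k)) + b') := by
  -- the base involution and the valuation bridges
  have hσσ : ∀ x, galAdicCompletionMap (L := E) c hw (galAdicCompletionMap (L := E) c hw x) = x :=
    galAdicCompletionMap_galAdicCompletionMap_of_smul_eq c w hc hw
  have hσO : ∀ x : 𝒪[w.1.adicCompletion E], galAdicCompletionMap (L := E) c hw x ∈ 𝒪[w.1.adicCompletion E] :=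
    fun x => mem_integer_galAdicCompletionMap c v w hw x
  have hιv : ∀ y : v.adicCompletion F, Valued.v (toPlace v w y) = Valued.v y :=
    fun y => Literature.NumberTheory.Automorphic.Liu2021.LemD1IndexedNonVacuityInertCofinite.valued_toPlace_of_isUnramifiedIn E v hunr w y
  have hϖv : Valued.v (toPlace v w k₀) = WithZero.exp (-1 : ℤ) := by rw [hιv, hk₀]
  have hjv : ∀ y : w.1.adicCompletion E, Valued.v (toPlace w.1 w₁ y) = Valued.v y ^ 2 :=
    valued_toPlace_eq_sq_of_eisenstein v hunr w w₁ haF hk₀ hθ hθv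
  obtain ⟨-, -, hirr, -⟩ := charpoly_ne_zero_of_eisensteinData hϖv hΘ hΘd hΘt
  -- unit norms of the inert `E_w ∕ F_v`, `2 ≠ 0`
  have hcc : c * c = 1 := algEquiv_mul_self_eq_one (F := F) hc
  have hnorm : ∀ u₁ : 𝒪[w.1.adicCompletion E], IsUnit u₁ → galAdicCompletionMap (L := E) c hw u₁ = u₁ →
      ∃ t : 𝒪[w.1.adicCompletion E], (t : w.1.adicCompletion E) * galAdicCompletionMap (L := E) c hw t = u₁ :=
    fun u₁ hu hσu => LocalFields.UnramifiedQuadraticNorm.exists_mul_galAdicCompletionMap_eq_of_inert c v hc hcc hunr w hw u₁ hu hσu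
  haveI : CharZero (w.1.adicCompletion E) := charZero_of_injective_algebraMap (algebraMap E (w.1.adicCompletion E)).injective
  have h20 : (2 : w.1.adicCompletion E) ≠ 0 := two_ne_zero
  -- the trace-unit seed `ω`
  obtain ⟨a, -, -, b, hb⟩ := exists_isUnit_moved_by_galAdicCompletionMap c v hc hunr w hw
  have hσb : galAdicCompletionMap (L := E) c hw b = -(b : w.1.adicCompletion E) := by
    have h1 : galAdicCompletionMap (L := E) c hw b * -(galAdicCompletionMap (L := E) c hw a - a) = 1 := by
      have h := congrArg (galAdicCompletionMap (L := E) c hw) hb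
      rw [map_mul, map_sub, hσσ, map_one] at h
      rw [neg_sub]; exact h
    have h2 : -(b : w.1.adicCompletion E) * -(galAdicCompletionMap (L := E) c hw a - a) = 1 := by rw [neg_mul_neg]; exact hb
    have hne : -(galAdicCompletionMap (L := E) c hw a - a) ≠ 0 := fun h0 => by rw [h0, mul_zero] at h2; exact zero_ne_one h2
    exact mul_right_cancel₀ hne (h1.trans h2.symm)
  have hω : Valued.v (-(a : w.1.adicCompletion E) * b) ≤ 1 := by
    rw [Valuation.map_mul, Valuation.map_neg]
    exact mul_le_one' ((v_le_one_iff_mem_integer _).2 a.2) ((v_le_one_iff_mem_integer _).2 b.2)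
  have hωtr : Valued.v (-(a : w.1.adicCompletion E) * b + galAdicCompletionMap (L := E) c hw (-(a : w.1.adicCompletion E) * b)) = 1 := by
    rw [map_mul, map_neg, hσb, show -(a : w.1.adicCompletion E) * b + -galAdicCompletionMap (L := E) c hw a * -(b : w.1.adicCompletion E) =
      (b : w.1.adicCompletion E) * (galAdicCompletionMap (L := E) c hw a - a) by ring, hb, map_one]
  -- ★ C8-odd
  exact SymmetricEigenframe.gate_at_generator_uniform (galAdicCompletionMap (L := E) c hw) hσσ hσO hnorm h20 hω hωtr J hJ hJh hjv s' ι' hs'ι hs's' hs'v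
    hι'j hι'ι hι'v hs'ι' hθv hι'θ hcoord hrE hnorm1 hnE hθs cfr φb hφb g u hirr hlam φ hφx hall hstar hcoordlam hunit hu1 hp1 hq hquad hb'

/-! ## ED. 2 — THE WILD UNIT ROW (★ C8-unit `gate_at_generator_wildUnit`; θ-package ★ `exists_thetaPackage_wildUnitRow_involution`)

On this row the involution letters `ι' hι'j hι'ι hι'v hs'ι' hrE hnE` above are read with `ι′α = −α` for the square root `α` of the wild unit `ι₁ d = ι₁(1 + w₀)` (the letters `hcoord hι'θ hθs`
of the uniformiser row are NOT used), plus `hfix` and `ι′θ ≠ θ`.  USE (F5, wild unit row): `ncard_isSelfDualLattice_stable_eq_phiTHn_inertPlace … P hP hPx (gateV_inertPlace_wildUnitRow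
c v hc hunr w hw w₁ haF hk₀ s' hθ hθv hs'ι hs's' hs'v hnorm1 J hJ hJh cfr φb hφb φ hstar hΘ hΘd hΘt hlam hφx hall hcoordlam ι' hι'j hι'ι hι'v hs'ι' hrE hnE hdw hw₀ hα hι'α hfix hι'θne) hI`. -/

section WildUnitRow

variable {α : w₁.1.adicCompletion M} {d w₀ : w.1.adicCompletion E} (hdw : d = 1 + w₀) {k : ℕ} (hw₀ : Valued.v w₀ = WithZero.exp (-(2 * (k : ℤ) + 1)))
  (hα : α ^ 2 = toPlace w.1 w₁ d) (hι'α : ι' α = -α)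
  (hfix : ∀ y : w₁.1.adicCompletion M, ι' y = y → ∃ x : w.1.adicCompletion E, toPlace w.1 w₁ x = y)
  (hι'θne : ι' θ ≠ θ)

include hc hunr haF hk₀ hθ hθv hs'ι hs's' hs'v hnorm1 hJ hJh hφb hstar hΘ hΘd hΘt hlam hφx hall hcoordlam hι'j hι'ι hι'v hs'ι' hrE hnE hdw hα hw₀ hι'α hfix hι'θne in
/-- **THE GATE `hgateV` ON THE WILD UNIT ROW** (★ F5-(0)'s binder, discharged): ★ C8-unit `gate_at_generator_wildUnit` at the place, its `τ`-free package read from the row's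
θ-package with `ι′` (`ι′α = −α`, `α² = ι₁(1 + w₀)`), the unit norms of the inert `E_w ∕ F_v` (★ `exists_mul_galAdicCompletionMap_eq_of_inert`), and the trace-unit seed `ω = −a·b`,
`b·(σ_w a − a) = 1` (★ FILE C `exists_isUnit_moved_by_galAdicCompletionMap`; `σ_w b = −b`, so `ω + σ_w ω = b·(σ_w a − a) = 1`).
[cite: Rogawski1990, §4.9 Lemma 4.9.3 p. 56, Prop. 4.9.1 (b) p. 55] [cite: Jacobowitz1962, §7 Thm. 7.1] [cite: SerreLocalFields1979, Ch. V §2 Prop. 3] -/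
theorem gateV_inertPlace_wildUnitRow (u' p' q' t' D' : w.1.adicCompletion E) (N'' b' : ℕ)
    (hunit : ((u', toPlace w.1 w₁ p' + toPlace w.1 w₁ q' * θ) : w.1.adicCompletion E × w₁.1.adicCompletion M) *
      RingHom.prodMap (galAdicCompletionMap (L := E) c hw) s' ((u', toPlace w.1 w₁ p' + toPlace w.1 w₁ q' * θ) : w.1.adicCompletion E × w₁.1.adicCompletion M) = 1)
    (hu1 : Valued.v (u' - 1) < 1) (hp1 : Valued.v (p' - 1) < 1) (hq : Valued.v q' = WithZero.exp (-(N'' : ℤ)))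
    (hquad : (toPlace w.1 w₁ p' + toPlace w.1 w₁ q' * θ) ^ 2 - toPlace w.1 w₁ t' * (toPlace w.1 w₁ p' + toPlace w.1 w₁ q' * θ) + toPlace w.1 w₁ D' = 0)
    (hb' : Valued.v (u' * u' - t' * u' + D') = WithZero.exp (-(b' : ℤ))) :
    (∃ x : Fin 3 → w.1.adicCompletion E, ∃ g₁ ∈ unitaryGroupOfForm (galAdicCompletionMap (L := E) c hw) (J : Matrix (Fin 3) (Fin 3) (w.1.adicCompletion E)),
      Submodule.span 𝒪[w.1.adicCompletion E] (Set.range fun k : Fin 3 =>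
        ((φ ((u', toPlace w.1 w₁ p' + toPlace w.1 w₁ q' * θ) : w.1.adicCompletion E × w₁.1.adicCompletion M)) ^ (k : ℕ)) *ᵥ x) =
        Submodule.span 𝒪[w.1.adicCompletion E] (Set.range ((g₁ : Matrix (Fin 3) (Fin 3) (w.1.adicCompletion E)))ᵀ)) ↔
    Even (WithZero.log (Valued.v (∑ k, ∑ i,
      galAdicCompletionMap (L := E) c hw (((cfr : Matrix (Fin 3) (Fin 3) (w.1.adicCompletion E)) *ᵥ Pi.single (endoPerm (Sum.inr 0)) (1 : w.1.adicCompletion E)) i) *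
      (J : Matrix (Fin 3) (Fin 3) (w.1.adicCompletion E)) i k *
      ((cfr : Matrix (Fin 3) (Fin 3) (w.1.adicCompletion E)) *ᵥ Pi.single (endoPerm (Sum.inr 0)) (1 : w.1.adicCompletion E)) k)) + b') := by
  -- the base involution and the valuation bridges
  have hσσ : ∀ x, galAdicCompletionMap (L := E) c hw (galAdicCompletionMap (L := E) c hw x) = x :=
    galAdicCompletionMap_galAdicCompletionMap_of_smul_eq c w hc hw
  have hσO : ∀ x : 𝒪[w.1.adicCompletion E], galAdicCompletionMap (L := E) c hw x ∈ 𝒪[w.1.adicCompletion E] :=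
    fun x => mem_integer_galAdicCompletionMap c v w hw x
  have hιv : ∀ y : v.adicCompletion F, Valued.v (toPlace v w y) = Valued.v y :=
    fun y => Literature.NumberTheory.Automorphic.Liu2021.LemD1IndexedNonVacuityInertCofinite.valued_toPlace_of_isUnramifiedIn E v hunr w y
  have hϖv : Valued.v (toPlace v w k₀) = WithZero.exp (-1 : ℤ) := by rw [hιv, hk₀]
  have hjv : ∀ y : w.1.adicCompletion E, Valued.v (toPlace w.1 w₁ y) = Valued.v y ^ 2 :=
    valued_toPlace_eq_sq_of_eisenstein v hunr w w₁ haF hk₀ hθ hθv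
  obtain ⟨-, -, hirr, -⟩ := charpoly_ne_zero_of_eisensteinData hϖv hΘ hΘd hΘt
  -- unit norms of the inert `E_w ∕ F_v`
  have hcc : c * c = 1 := algEquiv_mul_self_eq_one (F := F) hc
  have hnorm : ∀ u₁ : 𝒪[w.1.adicCompletion E], IsUnit u₁ → galAdicCompletionMap (L := E) c hw u₁ = u₁ →
      ∃ t : 𝒪[w.1.adicCompletion E], (t : w.1.adicCompletion E) * galAdicCompletionMap (L := E) c hw t = u₁ :=
    fun u₁ hu hσu => LocalFields.UnramifiedQuadraticNorm.exists_mul_galAdicCompletionMap_eq_of_inert c v hc hcc hunr w hw u₁ hu hσu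
  -- the wild unit `α·α = 1 + ι₁w₀`, `|ι₁w₀| < 1`, `|θ| < 1`
  have hα' : α * α = 1 + toPlace w.1 w₁ w₀ := by rw [← sq, hα, hdw, map_add, map_one]
  have hw₀1 : Valued.v w₀ < 1 := by rw [hw₀, ← WithZero.exp_zero]; exact WithZero.exp_lt_exp.2 (by omega)
  have hw' : Valued.v (toPlace w.1 w₁ w₀) < 1 := by rw [hjv, sq]; exact mul_lt_one' hw₀1 hw₀1
  have hθ1 : Valued.v θ < 1 := by rw [hθv, ← WithZero.exp_zero]; exact WithZero.exp_lt_exp.2 (by norm_num)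
  -- the trace-unit seed `ω`
  obtain ⟨a, -, -, b, hb⟩ := exists_isUnit_moved_by_galAdicCompletionMap c v hc hunr w hw
  have hσb : galAdicCompletionMap (L := E) c hw b = -(b : w.1.adicCompletion E) := by
    have h1 : galAdicCompletionMap (L := E) c hw b * -(galAdicCompletionMap (L := E) c hw a - a) = 1 := by
      have h := congrArg (galAdicCompletionMap (L := E) c hw) hb
      rw [map_mul, map_sub, hσσ, map_one] at h
      rw [neg_sub]; exact h
    have h2 : -(b : w.1.adicCompletion E) * -(galAdicCompletionMap (L := E) c hw a - a) = 1 := by rw [neg_mul_neg]; exact hb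
    have hne : -(galAdicCompletionMap (L := E) c hw a - a) ≠ 0 := fun h0 => by rw [h0, mul_zero] at h2; exact zero_ne_one h2
    exact mul_right_cancel₀ hne (h1.trans h2.symm)
  have hω : Valued.v (-(a : w.1.adicCompletion E) * b) ≤ 1 := by
    rw [Valuation.map_mul, Valuation.map_neg]
    exact mul_le_one' ((v_le_one_iff_mem_integer _).2 a.2) ((v_le_one_iff_mem_integer _).2 b.2)
  have hωtr : Valued.v (-(a : w.1.adicCompletion E) * b + galAdicCompletionMap (L := E) c hw (-(a : w.1.adicCompletion E) * b)) = 1 := by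
    rw [map_mul, map_neg, hσb, show -(a : w.1.adicCompletion E) * b + -galAdicCompletionMap (L := E) c hw a * -(b : w.1.adicCompletion E) =
      (b : w.1.adicCompletion E) * (galAdicCompletionMap (L := E) c hw a - a) by ring, hb, map_one]
  -- ★ C8-unit
  exact SymmetricEigenframe.gate_at_generator_wildUnit (galAdicCompletionMap (L := E) c hw) hσσ hσO hnorm hω hωtr J hJ hJh hjv s' ι' hs'ι hs's' hs'v
    hι'j hι'ι hι'v hs'ι' hι'α hα' hw' hfix hrE hnorm1 hnE hθ1 hι'θne cfr φb hφb g u hirr hlam φ hφx hall hstar hcoordlam hunit hu1 hp1 hq hquad hb'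

end WildUnitRow

end Literature.NumberTheory.Rogawski1990
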